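import Mathlib.Analysis.SpecialFunctions.Pow.Asymptotics
import Literature.Geometry.Lorentzian.ModelDataProofs
import Literature.Geometry.Lorentzian.DecaySymbols
import HarnessLib

/-!
# `KerrShieldedDataExist`, line `plug-the-second-sheet` — stub `stub_isotropicEnd`

The END clauses of Christodoulou-admissibility for a datum on `E3 = ℝ³` which is *exactly*
time-symmetric isotropic Schwarzschild outside a ball: if `D = (h, k)` is an initial data set on
`E3` with `h_y = ψ(y)⁴ δ`, `ψ(y) = 1 + M/(2‖y‖)` (`Schwarzschild.conformalFactor`) and `k_y = 0`
for `R < ‖y‖` (`R > 0`), then `E3` carries an asymptotically flat end `e` (the tautological one: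
`U = exteriorRegion R = {R < ‖y‖}`, chart = the identity diffeomorphism) which is

* the SOLE end of `E3` (`AFEnd.IsSoleEnd`): the complement of the far region `{R + 1 < ‖y‖}` is
  the closed ball of radius `R + 1`, compact;
* strongly asymptotically flat with mass `M` in the sense of Dafermos–Rodnianski
  (`AFEnd.IsStronglyAsymptoticallyFlatDR`, `h - (1 + 2M/r) δ = o₂(r⁻¹)`, `k = o₁(r⁻²)`): in the
  identity chart the components of `h` ARE `ψ⁴ δ` beyond `R` (the inverse chart of the
  tautological end has identity differential), and
  `ψ⁴ - (1 + 2M/r) = (3/2) M² r⁻² + (1/2) M³ r⁻³ + (1/16) M⁴ r⁻⁴` is a smooth symbol of order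
  `-2` (`IsBigOSmooth 2 (-2)`, the `O_k(r^a)` calculus of `DecaySymbols.lean`), so
  `∂^m (h - (1 + 2M/r) δ) = O(r^{-2-m}) = o(r^{-1-m})` for `m ≤ 2`; the components of `k` vanish
  identically (pullback of `0` beyond `R`, junk value `0` inside), so all their derivatives are
  `o` of anything.

This is the classical statement that the `t = 0` slice of Schwarzschild in isotropic
coordinates, `g = (1 + M/2r)⁴ δ`, `k = 0`, is strongly asymptotically flat with mass `M`
(Misner–Thorne–Wheeler 1973, (31.22); Dafermos–Rodnianski, Clay lectures (2013), App. B.2.3;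
Bartnik, CPAM 39 (1986), §1 for the structure of infinity). No hypothesis `0 ≤ M` is needed
for the end clauses (it is needed by the neighbouring stub producing the datum, where `ψ > 0`).

§1 is generic plumbing for ends of `E3` whose chart is the identity on coordinates (far
regions, sole end, chart components = values of the tensors); §2 is the decay computation;
§3 assembles the stub on the tautological end. Everything is proved; no definition and no
named fact is introduced.

References: C. W. Misner, K. S. Thorne, J. A. Wheeler, *Gravitation* (1973), (31.22);
M. Dafermos, I. Rodnianski, *Lectures on black holes and linear waves*, Clay Math. Proc. 17
(2013), App. B.2.3; R. Bartnik, *The mass of an asymptotically flat manifold*, CPAM 39 (1986),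
§1 and Def. 2.1; B. O'Neill, *Semi-Riemannian geometry* (1983), Ch. 3, p. 57.
-/

-- the doubled `FinalStateConjecture` path component is the summit/problem naming scheme, not a mistake
set_option linter.dupNamespace false

noncomputable section

open Set Filter Asymptotics Bornology Topology
open scoped Manifold ContDiff Topology InnerProductSpace
open Literature.Geometry.Lorentzian

namespace Summit.FinalStateConjecture.FinalStateConjecture.Theorems.SwallowTheDatum

/-! ## §1 Ends of `E3` whose chart is the identity on coordinates -/

section IdentityChart

/-- For an end of `E3` whose chart is the identity on coordinates and whose open set contains
`{R < ‖x‖}`, the far region `far e R'`, `R' ≥ R`, is literally `{x : E3 | R' < ‖x‖}`.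
Bartnik 1986, §1 (the sets `E_R`). [cite: Bartnik1986, §1] -/
theorem far_eq_of_chart_id (e : AFEnd E3) (hch : ∀ y : e.U, (e.chart y : E3) = y)
    (hU : ∀ x : E3, e.R < ‖x‖ → x ∈ e.U) {R' : ℝ} (hR' : e.R ≤ R') :
    e.far R' = {x : E3 | R' < ‖x‖} := by
  ext x
  simp only [AFEnd.far, mem_image, mem_preimage, mem_setOf_eq]
  constructor
  · rintro ⟨z, hz, rfl⟩
    rwa [hch z] at hz
  · intro hx
    exact ⟨⟨x, hU x (lt_of_le_of_lt hR' hx)⟩, by rw [hch]; exact hx, rfl⟩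

/-- **An end of `E3` whose chart is the identity on coordinates is the sole end of `E3`**: the
complement of the far region `{R + 1 < ‖x‖}` is the closed ball of radius `R + 1`, compact in
`ℝ³`. Bartnik 1986, §4 ("complete, one end"); Schoen–Yau 1979. [cite: Bartnik1986, §4] -/
theorem isSoleEnd_of_chart_id (e : AFEnd E3) (hch : ∀ y : e.U, (e.chart y : E3) = y)
    (hU : ∀ x : E3, e.R < ‖x‖ → x ∈ e.U) : e.IsSoleEnd := by
  refine ⟨e.R + 1, by linarith, ?_⟩
  rw [far_eq_of_chart_id e hch hU (by linarith)]
  have hset : ({x : E3 | e.R + 1 < ‖x‖})ᶜ = Metric.closedBall (0 : E3) (e.R + 1) := by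
    ext x
    simp [not_lt]
  rw [hset]
  exact isCompact_closedBall _ _

/-- **The inverse chart of an end of `E3` which is the identity on coordinates has identity
differential**: `dΦ_y v = v` (in the preferred chart of the open submanifold `exteriorRegion R`
the map reads as `id`, `OpensChart.mfderiv_eq`). O'Neill 1983, Ch. 3, p. 57; Bartnik 1986,
Def. 2.1. [folklore] -/
theorem mfderiv_dataChart_apply_of_eq (e : AFEnd E3) (hdc : ∀ y, e.dataChart y = (y : E3))
    (y : exteriorRegion e.R) (v : E3) : mfderiv (𝓡 3) (𝓡 3) e.dataChart y v = v := by
  have h : mfderiv (𝓡 3) (𝓡 3) e.dataChart y = ContinuousLinearMap.id ℝ E3 := by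
    have h1 := OpensChart.mfderiv_eq y e.dataChart id hdc differentiableAt_id
    rwa [fderiv_id] at h1
  rw [h]
  rfl

/-- **Chart components of the metric on a coordinate-identity end of `E3` are the values of the
metric**: `hCoeff e D x v w = h_x(v, w)` for `R < ‖x‖` (pullback along a map with identity
differential). Bartnik 1986, Def. 2.1, p. 675 (the components `(Φ_* g)_ij`).
[cite: Bartnik1986, Def. 2.1 p. 675] -/
theorem hCoeff_apply_of_dataChart_eq (e : AFEnd E3) (hdc : ∀ y, e.dataChart y = (y : E3))
    (D : InitialDataSet (𝓡 3) E3) {x : E3} (hx : e.R < ‖x‖) (v w : E3) :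
    AFEnd.hCoeff e D x v w = D.h.inner x v w := by
  rw [AFEnd.hCoeff_of_lt D hx]
  -- the tangent spaces are `E3` only up to unfolding `TangentSpace`: generalise, do not rewrite
  have key : ∀ (a : E3) (_ : a = x) (v' : E3) (_ : v' = v) (w' : E3) (_ : w' = w),
      D.h.inner a v' w' = D.h.inner x v w := by
    rintro a rfl v' rfl w' rfl
    rfl
  exact (pullbackBilin_apply (I := 𝓡 3) (I' := 𝓡 3) _ _ _ v w).trans
    (key _ (hdc ⟨x, hx⟩) _ (mfderiv_dataChart_apply_of_eq e hdc _ v) _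
      (mfderiv_dataChart_apply_of_eq e hdc _ w))

/-- **Chart components of `k` on a coordinate-identity end of `E3` are the values of `k`**:
`kCoeff e D x v w = k_x(v, w)` for `R < ‖x‖`. Christodoulou–Klainerman 1993, (1.0.9);
Bartnik 1986, Def. 2.1. [folklore] -/
theorem kCoeff_apply_of_dataChart_eq (e : AFEnd E3) (hdc : ∀ y, e.dataChart y = (y : E3))
    (D : InitialDataSet (𝓡 3) E3) {x : E3} (hx : e.R < ‖x‖) (v w : E3) :
    AFEnd.kCoeff e D x v w = D.k x v w := by
  rw [AFEnd.kCoeff_of_lt D hx]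
  have key : ∀ (a : E3) (_ : a = x) (v' : E3) (_ : v' = v) (w' : E3) (_ : w' = w),
      D.k a v' w' = D.k x v w := by
    rintro a rfl v' rfl w' rfl
    rfl
  exact (pullbackBilin_apply (I := 𝓡 3) (I' := 𝓡 3) _ _ _ v w).trans
    (key _ (hdc ⟨x, hx⟩) _ (mfderiv_dataChart_apply_of_eq e hdc _ v) _
      (mfderiv_dataChart_apply_of_eq e hdc _ w))

/-- The tautological end of `E3` beyond radius `R` is closed at infinity: the image under the
inclusion of `{R' ≤ ‖x‖} ⊆ exteriorRegion R` (preimage under the identity chart), `R < R'`, is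
the closed set `{x : E3 | R' ≤ ‖x‖}`. Bartnik 1986, §1. [cite: Bartnik1986, §1] -/
theorem isClosed_image_val_preimage_refl {R R' : ℝ} (hR' : R < R') :
    IsClosed (((↑) : exteriorRegion R → E3) ''
      ((Diffeomorph.refl (𝓡 3) (exteriorRegion R) ∞) ⁻¹' {x | R' ≤ ‖(x : E3)‖})) := by
  have key : ((↑) : exteriorRegion R → E3) ''
      ((Diffeomorph.refl (𝓡 3) (exteriorRegion R) ∞) ⁻¹' {x | R' ≤ ‖(x : E3)‖}) =
        {x : E3 | R' ≤ ‖x‖} := by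
    ext x
    simp only [mem_image, mem_preimage, mem_setOf_eq, Diffeomorph.coe_refl, id_eq]
    constructor
    · rintro ⟨z, hz, rfl⟩
      exact hz
    · intro hx
      exact ⟨⟨x, hR'.trans_le hx⟩, hx, rfl⟩
  rw [key]
  exact isClosed_le continuous_const continuous_norm

end IdentityChart

/-! ## §2 The decay of `ψ⁴ δ - (1 + 2M/r) δ` -/

section Decay

-- adapted from `isLittleO_norm_rpow_rpow_cobounded` (`Literature/Geometry/Lorentzian/HarmonicallyFlatDecay.lean`)
/-- Faster power decay is negligible against slower power decay at infinity:
`‖x‖ ^ p = o(‖x‖ ^ q)` along `Bornology.cobounded` for `p < q`. [folklore] -/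
theorem isLittleO_norm_rpow_rpow_cobounded_of_lt {E : Type*} [NormedAddCommGroup E] {p q : ℝ}
    (h : p < q) : (fun x : E ↦ ‖x‖ ^ p) =o[cobounded E] fun x ↦ ‖x‖ ^ q := by
  have h1 : Tendsto (fun x : E ↦ ‖x‖ ^ (p - q)) (cobounded E) (𝓝 0) := by
    have h' : Tendsto (fun x : E ↦ ‖x‖ ^ (-(q - p))) (cobounded E) (𝓝 0) :=
      (tendsto_rpow_neg_atTop (by linarith)).comp tendsto_norm_cobounded_atTop
    refine h'.congr fun x ↦ ?_
    rw [neg_sub]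
  have h2 : (fun x : E ↦ ‖x‖ ^ (p - q)) =o[cobounded E] fun _ ↦ (1 : ℝ) :=
    (isLittleO_one_iff ℝ).2 h1
  have h3 := h2.mul_isBigO (isBigO_refl (fun x : E ↦ ‖x‖ ^ q) (cobounded E))
  refine h3.congr' ((norm_rpow_mul_rpow_eventuallyEq (E := E) (p - q) q).trans ?_) ?_
  · exact Eventually.of_forall fun x ↦ by rw [sub_add_cancel]
  · exact Eventually.of_forall fun x ↦ one_mul _

/-- **`ψ⁴ δ - (1 + 2M/r) δ` is a smooth symbol of order `-2`** on `E3`, `ψ = 1 + M/(2r)`: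
`ψ⁴ - (1 + 2M/r) = r⁻² ((3/2) M² + (1/2) M³ r⁻¹ + (1/16) M⁴ r⁻²)` with `r⁻¹ ∈ O₂(r⁻¹)`
(`isBigOSmooth_inv_norm`) and the Leibniz rule of the symbol calculus. Misner–Thorne–Wheeler
1973, (31.22) (the expansion of the isotropic Schwarzschild metric). [cite: MTW1973, (31.22)] -/
theorem isBigOSmooth_conformalFactor_pow_four_sub (M : ℝ) :
    IsBigOSmooth (W := E3 →L[ℝ] E3 →L[ℝ] ℝ) 2 (-2) fun y : E3 ↦
      (Schwarzschild.conformalFactor M y ^ 4 - (1 + 2 * M / ‖y‖)) •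
        (innerSL ℝ : E3 →L[ℝ] E3 →L[ℝ] ℝ) := by
  have hu : IsBigOSmooth 2 (-1) fun y : E3 ↦ ‖y‖⁻¹ := isBigOSmooth_inv_norm
  have hu0 : IsBigOSmooth 2 0 fun y : E3 ↦ ‖y‖⁻¹ := hu.mono (by norm_num)
  have hu2 : IsBigOSmooth 2 (-2) fun y : E3 ↦ ‖y‖⁻¹ * ‖y‖⁻¹ := by
    have h := hu.mul hu
    rwa [show (-1 : ℝ) + -1 = -2 by norm_num] at h
  have hq : IsBigOSmooth 2 0 fun y : E3 ↦
      3 / 2 * M ^ 2 + M ^ 3 / 2 * ‖y‖⁻¹ + M ^ 4 / 16 * (‖y‖⁻¹ * ‖y‖⁻¹) :=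
    ((isBigOSmooth_const 2 (3 / 2 * M ^ 2)).add (hu0.const_mul _)).add
      ((hu0.mul₀ hu0).const_mul _)
  have hφ : IsBigOSmooth 2 (-2) fun y : E3 ↦
      Schwarzschild.conformalFactor M y ^ 4 - (1 + 2 * M / ‖y‖) := by
    have h := hu2.mul hq
    rw [add_zero] at h
    refine h.congr fun y ↦ ?_
    rw [Schwarzschild.conformalFactor_apply]
    ring
  exact hφ.smul_const _

/-- **The decay clauses.** If on the end `e` of data `D` on `E3` the chart components of `h` are
`ψ⁴ δ` beyond the inner radius and those of `k` vanish identically, then the data are strongly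
asymptotically flat with mass `M` in the sense of Dafermos–Rodnianski:
`h - (1 + 2M/r) δ = (ψ⁴ - 1 - 2M/r) δ ∈ O₂(r⁻²) ⊆ o₂(r⁻¹)` (symbols ignore the junk values
inside the ball, `IsBigOSmooth.congr_far`) and `k = 0 = o₁(r⁻²)`. Dafermos–Rodnianski 2013,
App. B.2.3; MTW 1973, (31.22). [cite: DafermosRodnianski2013, App. B.2.3] -/
theorem isStronglyAsymptoticallyFlatDR_of_hCoeff_eq (e : AFEnd E3) (D : InitialDataSet (𝓡 3) E3)
    (M : ℝ)
    (hh : ∀ x : E3, e.R < ‖x‖ → AFEnd.hCoeff e D x =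
      Schwarzschild.conformalFactor M x ^ 4 • (innerSL ℝ : E3 →L[ℝ] E3 →L[ℝ] ℝ))
    (hk : ∀ x : E3, AFEnd.kCoeff e D x = 0) :
    e.IsStronglyAsymptoticallyFlatDR D M := by
  have hF : IsBigOSmooth 2 (-2) fun y : E3 ↦
      AFEnd.hCoeff e D y - (1 + 2 * M / ‖y‖) • (innerSL ℝ : E3 →L[ℝ] E3 →L[ℝ] ℝ) :=
    (isBigOSmooth_conformalFactor_pow_four_sub M).congr_far (R₁ := e.R) fun y hy ↦ by
      -- `δ = innerSL ℝ` is `ℝ`-semilinear for `starRingEnd ℝ`, used at the (defeq) `ℝ`-linear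
      -- type, so `sub_smul` does not rewrite syntactically: check the identity entrywise
      rw [hh y hy]
      ext v w
      change (Schwarzschild.conformalFactor M y ^ 4 - (1 + 2 * M / ‖y‖)) * ⟪v, w⟫_ℝ =
        Schwarzschild.conformalFactor M y ^ 4 * ⟪v, w⟫_ℝ - (1 + 2 * M / ‖y‖) * ⟪v, w⟫_ℝ
      ring
  unfold AFEnd.IsStronglyAsymptoticallyFlatDR AFEnd.IsStronglyAsymptoticallyFlatWith
  refine ⟨fun m hm ↦ ?_, fun m _ ↦ ?_⟩
  · exact (hF.isBigO hm).trans_isLittleO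
      (isLittleO_norm_rpow_rpow_cobounded_of_lt (by linarith))
  · refine isLittleO_norm_iteratedFDeriv_of_forall_eq_zero (fun y ↦ ?_) m _ _
    exact hk y

end Decay

/-! ## §3 The stub -/

/-- **Stub `stub_isotropicEnd` of line `plug-the-second-sheet` (crux
`stmt-FinalStateConjecture-10055`): the end clauses of admissibility for a datum on `E3` which
is exactly time-symmetric isotropic Schwarzschild beyond radius `R`.** For an initial data set
`D` on `E3` with `h_y(v, w) = ψ(y)⁴ ⟪v, w⟫`, `ψ = 1 + M/(2‖y‖)`, and `k_y = 0` for `R < ‖y‖`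
(`0 < R`), the tautological end `U = exteriorRegion R` with the identity chart is the sole end of
`E3` (complement of `{R + 1 < ‖y‖}` = closed ball, compact) and the data are
Dafermos–Rodnianski strongly asymptotically flat on it with mass `M`
(`h - (1 + 2M/r) δ = ((3/2) M² r⁻² + (1/2) M³ r⁻³ + (1/16) M⁴ r⁻⁴) δ = o₂(r⁻¹)`, `k = 0`).
Misner–Thorne–Wheeler 1973, (31.22); Dafermos–Rodnianski 2013, App. B.2.3; Bartnik 1986, §1.
[cite: DafermosRodnianski2013, App. B.2.3] -/
theorem stub_isotropicEnd :
    ∀ (D : InitialDataSet (𝓡 3) E3) (M R : ℝ), 0 ≤ M → 0 < R →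
      (∀ y : E3, R < ‖y‖ → (∀ v w : E3, D.h.inner y v w = Schwarzschild.conformalFactor M y ^ 4 * ⟪v, w⟫_ℝ) ∧ D.k y = 0) →
      ∃ e : AFEnd E3, e.IsSoleEnd ∧ e.IsStronglyAsymptoticallyFlatDR D M := by
  intro D M R _ hR hD
  refine ⟨⟨exteriorRegion R, R, hR, Diffeomorph.refl (𝓡 3) (exteriorRegion R) ∞,
    fun R' hR' ↦ isClosed_image_val_preimage_refl hR'⟩, ?_, ?_⟩
  · exact isSoleEnd_of_chart_id _ (fun _ ↦ rfl) (fun _ h ↦ h)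
  · refine isStronglyAsymptoticallyFlatDR_of_hCoeff_eq _ D M (fun x hx ↦ ?_) (fun x ↦ ?_)
    · ext v w
      rw [hCoeff_apply_of_dataChart_eq _ (fun _ ↦ rfl) D hx v w, (hD x hx).1 v w]
      rfl
    · by_cases hx : R < ‖x‖
      · ext v w
        rw [kCoeff_apply_of_dataChart_eq _ (fun _ ↦ rfl) D hx v w, (hD x hx).2]
        rfl
      · exact dif_neg hx

end Summit.FinalStateConjecture.FinalStateConjecture.Theorems.SwallowTheDatum

end
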